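import Literature.MathematicalPhysics.QuantumFieldTheory.Balaban1983to89.B9SupplySockB9P3ZdGenuineGop
import Literature.MathematicalPhysics.QuantumFieldTheory.Balaban1983to89.B9Eq316AveragingTransposeZdLinear

/-!
# `Balaban1983to89.B9SupplySockB9P3ZdAllLettersZd` — THE J-N06→N05 JUNCTION'S LETTER RECORD WITH ALL FOUR LETTERS GENUINE at the `ℤᵈ × 𝔸` carrier:
# `Δ′(U₀)` of [Balaban1985BackgroundPropagators] (3.10) (dag-n06-w2's `withDpZd`), `Q*aQ` of (3.16) (dag-n06-b's EDITION P `withQQP τ L ΛbP`), `D R(U₀) D*` of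
# (3.20)–(3.26) (dag-n06-w4's `opsLandau τ`) and `G(U₀) = (Ω₀Δ_aΩ₀)⁻¹` of (3.27) built on all three (dag-n06-w4's `withGopZd`) — the record
# `opsAllZd τ L ΛbP ops₀ := withGopZd (opsLandau τ (withDpZd (withQQP τ L ΛbP ops₀)))` carries `CurvAtInAk ∧ LandauAt ∧ GopAddAt ∧ AvgAtγ` as THEOREMS, the
# displayed `Q*aQ`-linearity of `B9SupplySockB9P3ZdGenuineGop` is DISCHARGED (dag-n06-b's `QQZdP_add ∕ _smul_real`), and `InvAt` follows from THEOREM 3.11 AT THE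
# MEMBER IN PRINT'S CURRENCY ALONE; the finite-`Ω₀` supplier of the junction is then left with exactly: the norm dictionary `DictAt`, [B8] Prop. 6 `Prop6At`,
# [B9] Thm 3.3's local block `h33U`, [B9] Thm 3.11's positivity `PosDefInClassAt`, and the class laws (`SeesDom`, `LevelSepPP`)

statement-level skeleton of published theorems with citation tags; proofs where landed; nothing here is a claim about the
Yang–Mills mass gap

PDF held: `paper:balaban1985-cmp99-background-propagators` ([4] = B9; journal page = PDF page + 388), pp. 392–395 (3.10), (3.16), (3.20)–(3.27), p. 399 Thm 3.3,
p. 416 Thm 3.11; `paper:balaban1985-cmp99-regular-spaces-gauge-fixing` (B8) p. 86 (1.58)–(1.59), p. 99 Prop. 6 — quoted in the imported files, BY NAME.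

WHY THIS FILE (cell `pub-ymgap`, HUMAN RULING D-0062 ∕ D-0149; seat `pub-ymgap-dag-n06-w4` (g2), node N06 = [B9]; INTENT-4, INBOX l.27047; dag-n06-b g17 WORD
l.27102 «compose EDITION P `withQQP`; the linearity is MINE, BY NAME»; count-neutral).  With p596576 (`…AveragingTransposeZdPrinted`: `withQQP`, `avgAtγ_withQQP`),
p597917-class `…TransposeZdLinear` (`QQZdP_add ∕ _smul_real`) and this seat's p596512 (`opsGenuine`, `invAt_opsGenuine_of_posDef`, `sockB9P3D4γI_at_opsGenuine`),
every OPERATOR LETTER of `OpsZd` is an object.  This file is the bookkeeping knot: the four-letter record, its five object-borne binders, and the supplier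
with all letter-binders replaced — so that what the N05 knit must supply on the finite-`Ω₀` road is print's THEOREMS (3.3, 3.11, Prop. 6) and the dictionary,
nothing about letters.

WHAT IS PROVED (0 sorry; definitions with bodies + theorems; no `instance`, no `notation`).
* §1 `opsAllZd τ L ΛbP ops₀` (def) + field readings (`rfl`): `Dp = DpZd`, `QQ = QQZdP`, `DRDs` = `opsLandau`'s, `Gop` = `gopZd` over the three.
* §2 ★ `qqLinearAt_withQQP` ∕ ★ `qqLinearInClassAt_withQQP` — the `Q*aQ` letter of EDITION P is ℝ-linear in `A` at every unitary `U₀` under the class's BOX clause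
  (dag-n06-b's `QQZdP_add ∕ QQZdP_smul_real`, `2 ≤ L`) — `B9SupplySockB9P3ZdGenuineGop.QQLinearInClassAt` DISCHARGED.
* §3 the binders: ★★ `curvAtInAk_opsAllZd`, ★★ `landauAt_opsAllZd`, ★★ `gopAddAt_opsAllZd`, ★★ `avgAtγ_opsAllZd` (dag-n06-b's `avgAtγ_withQQP` read at the record —
  the binder sees only the `QQ` field), ★★★ `invAt_opsAllZd_of_posDef` (`InvAt` from `PosDefInClassAt` — Theorem 3.11 at the member in print's currency — and the
  box clause ALONE), ★ `five_binders_opsAllZd`.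
* §4 ★★★ `sockB9P3D4γI_at_opsAllZd` — THE FINITE-`Ω₀` (MARGIN-ROAD) SUPPLIER FOR THE FOUR-LETTER RECORD: dag-n06-b's `sockB9P3D4γI_at` with `InvAt ∕ CurvAtInAk ∕
  LandauAt ∕ AvgAtγ` ALL replaced by theorems; hypotheses left: `DictAt`, `Prop6At`, `PosDefInClassAt` (Thm 3.11), `h33U` (Thm 3.3's (3.42)∕(3.46)∕(3.47) block for
  the frame), `SeesDom` + `LevelSepPP` (class laws), `Margin2`, finite `Ω₀`, `2 ≤ d`, `2 ≤ L`, `1 ≤ M`, the `τ`-hypotheses and `|Re τ(x*y)| ≤ C_τ‖x‖‖y‖`;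
  constants `c69 := 14(d−1)`, `q := qQ d L C_τ β_τ s`.

HONEST SCOPE.  Bookkeeping over p586146 (w2), p585863∕p595052∕p596512 (w4), p596576 + `…TransposeZdLinear` (n06-b) — cited BY NAME, nothing re-proved; NO estimate
of [B9] is proved here: Theorem 3.11 (`PosDefInClassAt`), Theorem 3.3 (`h33U`), Prop. 6 (`Prop6At`) and the dictionary (`DictAt`) REMAIN displayed hypotheses
— they are print's theorems at the carrier, N06's object-bound; the objects `R ∕ G` exist at members with FINITE `Ω₀` only (the univ road keeps `ops₀`'s
letters there).  Count-neutral; N05 ∕ N06 NOT discharged; K1⁷ `stmt-QuantumFields-20542` NOT closed; one finite `𝕋⁴` programme at fixed `ε`, Bałaban as printed;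
R4 closes only the conditional finite-`𝕋⁴` rung `BalabanLadder.UV` — nothing continuum ∕ ℝ⁴ ∕ OS ∕ mass gap ∕ Clay.  Unit `pub-ymgap-dag-n06-w4` (g2), 2026-08-28.
-/

noncomputable section

namespace Literature.MathematicalPhysics.QuantumFieldTheory.Balaban1983to89.B9SupplySockB9P3ZdAllLettersZd

open B7Prop1Explicit
open B7Prop1Local (InBox loK bondHiK)
open B7Prop2Explicit (unitaryUnits)
open B8LeafModelZd (ZdIdx)
open B9SupplySockB9P3ZdLetters (OpsZd deltaAOf)
open B9SupplySockB9P3ZdLettersOmega (Margin2)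
open B9SupplySockB9P3ZdAt (DictAt Prop6At InvAt GopAddAt LandauAt)
open B9SupplySockB9P3ZdBeta (SockB9P3D4β)
open B9SupplySockB9P3ZdGamma (SeesDom AvgAtγ)
open B9SupplySockB9P3ZdGammaInAk (CurvAtInAk sockB9P3D4γI_at)
open B9SupplySockB9P3ZdGammaInAkDpZd (withDpZd)
open B9Eq369CurvSmallZd (DpZd)
open B9Eq321LandauProjectionZd (opsLandau)
open B9Eq327GreenZd (withGopZd gopZd RegularInClassAt)
open B9SupplySockB9P3ZdGenuineGop (opsGenuine QQLinearAt QQLinearInClassAt PosDefInClassAt curvAtInAk_opsGenuine landauAt_opsGenuine gopAddAt_opsGenuine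
  invAt_opsGenuine_of_posDef regularInClassAt_opsGenuine_of_posDef)
open B9Eq316AveragingTransposeZd (qQ betaTau)
open B9Eq316AveragingTransposeZdPrinted (QQZdP withQQP LevelSepPP avgAtγ_withQQP)
open B9Eq316AveragingTransposeZdLinear (QQZdP_add QQZdP_smul_real)

-- `Site` alone could resolve to the torus sites of `Setup.lean`; re-export the `ℤ^d` sites of `B7Prop1Explicit`.
export B7Prop1Explicit (Site)

variable {d : ℕ} {𝔸 : Type*} [CStarAlgebra 𝔸] [FiniteDimensional ℝ 𝔸] (τ : 𝔸 →ₗ[ℂ] ℂ) (L : ℕ)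

/-! ## §1 The four-letter record -/

/-- **THE RECORD WITH ALL FOUR LETTERS GENUINE**: `ops₀` with `QQ := Q*aQ` (EDITION P, n06-b), then `Dp := Δ′` (w2), then `DRDs := D R(U₀) 𝟙_{Ω₀}D*` (w4 g0), then
`Gop := (Ω₀Δ_aΩ₀)⁻¹` (w4 g2) built on those three — nothing of `ops₀` is read at members with finite `Ω₀` in print's regime.
[cite: Balaban1985BackgroundPropagators, (3.10) p.392, (3.16) p.393, (3.26)–(3.27) p.395] -/
def opsAllZd (ΛbP : ℕ → ℕ → Set (Site d × Fin d)) (ops₀ : ℝ → ZdIdx d L → ℕ → OpsZd d 𝔸) : ℝ → ZdIdx d L → ℕ → OpsZd d 𝔸 :=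
  opsGenuine τ (withQQP τ L ΛbP ops₀)

variable (ΛbP : ℕ → ℕ → Set (Site d × Fin d)) (ops₀ : ℝ → ZdIdx d L → ℕ → OpsZd d 𝔸) (M : ℝ) (i : ZdIdx d L) (m : ℕ)

/-- the record IS the three-letter composite over EDITION P. [cite: Balaban1985BackgroundPropagators, (3.26) p.395 (bookkeeping)] -/
theorem opsAllZd_eq : opsAllZd τ L ΛbP ops₀ = withGopZd (opsLandau τ (withDpZd (withQQP τ L ΛbP ops₀))) := rfl

/-- the `Dp` field is the genuine `Δ′`. [cite: Balaban1985BackgroundPropagators, (3.10) p.392] -/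
theorem opsAllZd_Dp : (opsAllZd τ L ΛbP ops₀ M i m).Dp = DpZd i.η := rfl

/-- the `QQ` field is the genuine `Q*aQ` of EDITION P. [cite: Balaban1985BackgroundPropagators, (3.16) p.393] -/
theorem opsAllZd_QQ : (opsAllZd τ L ΛbP ops₀ M i m).QQ = QQZdP τ L ΛbP i m := rfl

/-- the `DRDs` field is `opsLandau`'s genuine `D R(U₀) 𝟙_{Ω₀}D*`. [cite: Balaban1985BackgroundPropagators, (3.26) p.395] -/
theorem opsAllZd_DRDs : (opsAllZd τ L ΛbP ops₀ M i m).DRDs = (opsLandau τ (withDpZd (withQQP τ L ΛbP ops₀)) M i m).DRDs := rfl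

/-- the `Gop` field is the genuine `G(U₀)` over the three genuine co-letters. [cite: Balaban1985BackgroundPropagators, (3.27) p.395] -/
theorem opsAllZd_Gop (U₀ : Site d → Fin d → 𝔸ˣ) (J : Site d → Fin d → 𝔸) :
    (opsAllZd τ L ΛbP ops₀ M i m).Gop U₀ J = gopZd i.η (opsLandau τ (withDpZd (withQQP τ L ΛbP ops₀)) M i m) (i.Ω 0) U₀ J := rfl

/-! ## §2 The `Q*aQ` letter of EDITION P is ℝ-linear (n06-b, BY NAME): `QQLinearInClassAt` discharged -/

section Linear

variable [Nontrivial 𝔸]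

/-- ★ **`QQLinearAt` FOR EDITION P** at every unitary `U₀` under the class's BOX clause (`2 ≤ L`): the letter `QQZdP τ L ΛbP i m U₀` is the restriction of an
ℝ-linear map — n06-b's `QQZdP_add ∕ QQZdP_smul_real`. [cite: Balaban1985BackgroundPropagators, (3.16) p.393 («an operator Q*aQ»)] -/
theorem qqLinearAt_withQQP (hL : 2 ≤ L)
    (hbox : ∀ j, j ≤ m → ∀ c ∈ ΛbP m j, ∀ x, InBox (loK L j c.1) (bondHiK L j c.1 c.2) x → x ∈ i.Ω (j - 1))
    {U₀ : Site d → Fin d → 𝔸ˣ} (hU₀ : ∀ x κ, U₀ x κ ∈ unitaryUnits 𝔸) :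
    QQLinearAt (withQQP τ L ΛbP ops₀ M i m) U₀ := by
  refine ⟨{ toFun := QQZdP τ L ΛbP i m U₀, map_add' := QQZdP_add τ L hL hbox hU₀, map_smul' := QQZdP_smul_real τ L hL hbox hU₀ },
    fun A => rfl⟩

variable {I : Type} (bg : I → B9.Backgrounds) (mem : ℝ → ZdIdx d L → ℕ → I)
variable (ιCfg : ∀ (M : ℝ) (i : ZdIdx d L) (m : ℕ) (U₀ : Site d → Fin d → 𝔸ˣ),
  (∀ x κ, U₀ x κ ∈ unitaryUnits 𝔸) → (bg (mem M i m)).Cfg)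

/-- ★ **`QQLinearInClassAt` FOR EDITION P** (every frame, all `c35 a₃`: the class guards are not even used — unitarity suffices).
[cite: Balaban1985BackgroundPropagators, (3.16) p.393] -/
theorem qqLinearInClassAt_withQQP (hL : 2 ≤ L)
    (hbox : ∀ j, j ≤ m → ∀ c ∈ ΛbP m j, ∀ x, InBox (loK L j c.1) (bondHiK L j c.1 c.2) x → x ∈ i.Ω (j - 1)) (c35 a₃ : ℝ) :
    QQLinearInClassAt bg mem ιCfg (withQQP τ L ΛbP ops₀) c35 a₃ M i m :=
  fun _ _ hU₀ _ _ _ => qqLinearAt_withQQP τ L ΛbP ops₀ M i m hL hbox hU₀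

/-- the box clause is the first conjunct of n06-b's class law `LevelSepPP`. [cite: Balaban1985RegularSpaces, (1.31) p.81 (collars)] -/
theorem hbox_of_levelSepPP {s : ℕ} (hlaw : LevelSepPP L m i.Ω ΛbP s) :
    ∀ j, j ≤ m → ∀ c ∈ ΛbP m j, ∀ x, InBox (loK L j c.1) (bondHiK L j c.1 c.2) x → x ∈ i.Ω (j - 1) :=
  fun j hj c hc x hx => (hlaw j hj c hc x hx).1

end Linear

/-! ## §3 The five object-borne binders at the four-letter record -/

section Binders

variable [Nontrivial 𝔸]
variable {I : Type} (geo : I → B9.Geometry) (bg : I → B9.Backgrounds) (GA : ∀ i, B9.KernelFamily (geo i) (bg i))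
variable (mem : ℝ → ZdIdx d L → ℕ → I)
variable (ιCfg : ∀ (M : ℝ) (i : ZdIdx d L) (m : ℕ) (U₀ : Site d → Fin d → 𝔸ˣ),
  (∀ x κ, U₀ x κ ∈ unitaryUnits 𝔸) → (bg (mem M i m)).Cfg)
variable (ιLoc : ∀ (M : ℝ) (i : ZdIdx d L) (m : ℕ), (Site d → Fin d → 𝔸) → (geo (mem M i m)).Loc)

/-- ★★ **`CurvAtInAk` AT THE FOUR-LETTER RECORD** (`1 ≤ L`, `1 ≤ M`). [cite: Balaban1985BackgroundPropagators, (3.69) p.404; Balaban1985RegularSpaces, (1.7) p.77] -/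
theorem curvAtInAk_opsAllZd (hL : 1 ≤ L) {M : ℝ} (hM : 1 ≤ M) (i : ZdIdx d L) (m : ℕ) :
    CurvAtInAk L (opsAllZd τ L ΛbP ops₀) (14 * ((d - 1 : ℕ) : ℝ)) M i m :=
  curvAtInAk_opsGenuine τ (withQQP τ L ΛbP ops₀) hL hM i m

omit [Nontrivial 𝔸] in
/-- ★★ **`LandauAt` AT THE FOUR-LETTER RECORD** (finite `Ω₀`, the `τ`-hypotheses). [cite: Balaban1985BackgroundPropagators, (3.20)–(3.22) p.394; Balaban1985RegularSpaces, (1.42) p.83] -/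
theorem landauAt_opsAllZd [NeZero L] (hτt : ∀ a b : 𝔸, τ (a * b) = τ (b * a)) (hτs : ∀ a : 𝔸, τ (star a) = starRingEnd ℂ (τ a))
    (hτp : ∀ a : 𝔸, a ≠ 0 → 0 < (τ (star a * a)).re) (c35 a₃ : ℝ) (hΩ : (i.Ω 0).Finite) :
    LandauAt bg L mem ιCfg (opsAllZd τ L ΛbP ops₀) c35 a₃ M i m :=
  landauAt_opsGenuine τ (withQQP τ L ΛbP ops₀) M i m bg mem ιCfg hτt hτs hτp c35 a₃ hΩ

omit [Nontrivial 𝔸] in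
/-- ★★ **`GopAddAt` AT THE FOUR-LETTER RECORD, NO HYPOTHESIS.** [cite: Balaban1985BackgroundPropagators, (3.27) p.395] -/
theorem gopAddAt_opsAllZd : GopAddAt L (opsAllZd τ L ΛbP ops₀) M i m :=
  gopAddAt_opsGenuine τ (withQQP τ L ΛbP ops₀) M i m

/-- ★★ **`AvgAtγ` AT THE FOUR-LETTER RECORD** — n06-b's `avgAtγ_withQQP` (p596576) read at the record (the binder sees only the `QQ` field, which is `QQZdP` by
`rfl`): `2 ≤ d`, `2 ≤ L`, `|Re τ(x*y)| ≤ C_τ‖x‖‖y‖`, class law `LevelSepPP … s`, constant `q = qQ d L C_τ β_τ s`. [cite: Balaban1985BackgroundPropagators, (3.16) p.393; Balaban1985RegularSpaces, (1.56), (1.58) p.86] -/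
theorem avgAtγ_opsAllZd (hd : 2 ≤ d) (hL : 2 ≤ L) {Cτ : ℝ} (hCτ : ∀ x y : 𝔸, |(τ (star x * y)).re| ≤ Cτ * ‖x‖ * ‖y‖) {s : ℕ}
    (hlaw : LevelSepPP L m i.Ω ΛbP s) : AvgAtγ L (opsAllZd τ L ΛbP ops₀) (qQ d L Cτ (betaTau τ) s) ΛbP M i m := by
  intro U₀ hU₀ A hOn j hj x μ hb
  exact avgAtγ_withQQP τ L hd hL hCτ ΛbP ops₀ M i m hlaw U₀ hU₀ A hOn j hj x μ hb

/-- ★★★ **`InvAt` AT THE FOUR-LETTER RECORD FROM THEOREM 3.11 AT THE MEMBER (PRINT'S CURRENCY) ALONE** — finite `Ω₀`, `2 ≤ L`, the class's box clause: the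
`Q*aQ`-linearity hypothesis of `invAt_opsGenuine_of_posDef` is now a theorem (§2). [cite: Balaban1985BackgroundPropagators, (3.27) p.395, Thm 3.11 p.416; Balaban1985RegularSpaces, (1.58) p.86] -/
theorem invAt_opsAllZd_of_posDef (hL : 2 ≤ L) (c35 a₃ : ℝ) (hΩ : (i.Ω 0).Finite)
    (hbox : ∀ j, j ≤ m → ∀ c ∈ ΛbP m j, ∀ x, InBox (loK L j c.1) (bondHiK L j c.1 c.2) x → x ∈ i.Ω (j - 1))
    (hpos : PosDefInClassAt τ bg mem ιCfg (opsAllZd τ L ΛbP ops₀) c35 a₃ M i m) :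
    InvAt bg L mem ιCfg (opsAllZd τ L ΛbP ops₀) c35 a₃ M i m :=
  invAt_opsGenuine_of_posDef τ bg mem ιCfg (withQQP τ L ΛbP ops₀) c35 a₃ M i m hΩ
    (qqLinearInClassAt_withQQP τ L ΛbP ops₀ M i m bg mem ιCfg hL hbox c35 a₃) hpos

/-- **`RegularInClassAt` (the qualitative Thm 3.11 of `B9Eq327GreenZd`) for the three co-letter record, from print's positivity.**
[cite: Balaban1985BackgroundPropagators, Thm 3.11 p.416] -/
theorem regularInClassAt_opsAllZd_of_posDef (hL : 2 ≤ L) (c35 a₃ : ℝ) (hΩ : (i.Ω 0).Finite)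
    (hbox : ∀ j, j ≤ m → ∀ c ∈ ΛbP m j, ∀ x, InBox (loK L j c.1) (bondHiK L j c.1 c.2) x → x ∈ i.Ω (j - 1))
    (hpos : PosDefInClassAt τ bg mem ιCfg (opsAllZd τ L ΛbP ops₀) c35 a₃ M i m) :
    RegularInClassAt bg mem ιCfg (opsLandau τ (withDpZd (withQQP τ L ΛbP ops₀))) c35 a₃ M i m :=
  regularInClassAt_opsGenuine_of_posDef τ bg mem ιCfg (withQQP τ L ΛbP ops₀) c35 a₃ M i m hΩ
    (qqLinearInClassAt_withQQP τ L ΛbP ops₀ M i m bg mem ιCfg hL hbox c35 a₃) hpos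

/-- ★ **THE FIVE OBJECT-BORNE BINDERS AT ONCE** at the four-letter record (finite `Ω₀`, `2 ≤ d`, `2 ≤ L`, `1 ≤ M`, the `τ`-hypotheses, class law `LevelSepPP`):
`CurvAtInAk ∧ LandauAt ∧ GopAddAt ∧ AvgAtγ` unconditionally and `InvAt` under Theorem 3.11's positivity. [cite: Balaban1985BackgroundPropagators, (3.69) p.404, (3.16) p.393, (3.20)–(3.27) pp.394–395, Thm 3.11 p.416] -/
theorem five_binders_opsAllZd [NeZero L] (hd : 2 ≤ d) (hL : 2 ≤ L)
    (hτt : ∀ a b : 𝔸, τ (a * b) = τ (b * a)) (hτs : ∀ a : 𝔸, τ (star a) = starRingEnd ℂ (τ a))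
    (hτp : ∀ a : 𝔸, a ≠ 0 → 0 < (τ (star a * a)).re) {Cτ : ℝ} (hCτ : ∀ x y : 𝔸, |(τ (star x * y)).re| ≤ Cτ * ‖x‖ * ‖y‖)
    (c35 a₃ : ℝ) {M : ℝ} (hM : 1 ≤ M) (i : ZdIdx d L) (m : ℕ) (hΩ : (i.Ω 0).Finite) {s : ℕ} (hlaw : LevelSepPP L m i.Ω ΛbP s)
    (hpos : PosDefInClassAt τ bg mem ιCfg (opsAllZd τ L ΛbP ops₀) c35 a₃ M i m) :
    CurvAtInAk L (opsAllZd τ L ΛbP ops₀) (14 * ((d - 1 : ℕ) : ℝ)) M i m ∧ LandauAt bg L mem ιCfg (opsAllZd τ L ΛbP ops₀) c35 a₃ M i m ∧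
      GopAddAt L (opsAllZd τ L ΛbP ops₀) M i m ∧ AvgAtγ L (opsAllZd τ L ΛbP ops₀) (qQ d L Cτ (betaTau τ) s) ΛbP M i m ∧
        InvAt bg L mem ιCfg (opsAllZd τ L ΛbP ops₀) c35 a₃ M i m :=
  ⟨curvAtInAk_opsAllZd τ L ΛbP ops₀ (le_trans (by norm_num) hL) hM i m,
    landauAt_opsAllZd τ L ΛbP ops₀ M i m bg mem ιCfg hτt hτs hτp c35 a₃ hΩ, gopAddAt_opsAllZd τ L ΛbP ops₀ M i m,
    avgAtγ_opsAllZd τ L ΛbP ops₀ M i m hd hL hCτ hlaw,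
    invAt_opsAllZd_of_posDef τ L ΛbP ops₀ M i m bg mem ιCfg hL c35 a₃ hΩ (hbox_of_levelSepPP L ΛbP i m hlaw) hpos⟩

/-! ## §4 The finite-`Ω₀` supplier with every letter-binder replaced by a theorem -/

/-- ★★★ **THE J-N06→N05 SUPPLIER ON THE FINITE-`Ω₀` (MARGIN) ROAD FOR THE FOUR-LETTER RECORD** — dag-n06-b's `sockB9P3D4γI_at` (p585159) with `InvAt`,
`CurvAtInAk`, `LandauAt`, `AvgAtγ` ALL theorems for `opsAllZd τ L ΛbP ops₀`.  What the knit supplies: `DictAt` (norm dictionary for its frame), `Prop6At`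
([B8] Prop. 6 in [B9]'s shape), `PosDefInClassAt` ([B9] Thm 3.11 at the member, print's currency), `h33U` ([B9] Thm 3.3's block (3.42)∕(3.46)∕(3.47) for its
frame), the class laws `SeesDom` and `LevelSepPP`, `Margin2`, finiteness of `Ω₀`.  Constants: `c69 := 14(d−1)`, `q := qQ d L C_τ β_τ s`.
[cite: Balaban1985BackgroundPropagators, Thm 3.3 p.399, Thm 3.11 p.416, (3.27) p.395; Balaban1985RegularSpaces, (1.58)–(1.59) p.86, Prop. 6 p.99] -/
theorem sockB9P3D4γI_at_opsAllZd [NeZero L] (hd2 : 2 ≤ d) (hL : 2 ≤ L)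
    (hτt : ∀ a b : 𝔸, τ (a * b) = τ (b * a)) (hτs : ∀ a : 𝔸, τ (star a) = starRingEnd ℂ (τ a))
    (hτp : ∀ a : 𝔸, a ≠ 0 → 0 < (τ (star a * a)).re) {Cτ : ℝ} (hCτ : ∀ x y : 𝔸, |(τ (star x * y)).re| ≤ Cτ * ‖x‖ * ‖y‖)
    {c35 c₆ K₆ a₃ : ℝ} {M : ℝ} (hM1 : 1 ≤ M) (i : ZdIdx d L) (hMi : Margin2 i.Ω) (hΩ : (i.Ω 0).Finite) {m : ℕ}
    (hdict : DictAt geo bg GA L mem ιCfg ιLoc (opsAllZd τ L ΛbP ops₀) M i m) (hP6 : Prop6At bg L mem ιCfg c35 c₆ K₆ M i m)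
    (hpos : PosDefInClassAt τ bg mem ιCfg (opsAllZd τ L ΛbP ops₀) c35 a₃ M i m)
    (hsee : SeesDom L m (i.Ω 0) ΛbP) {s : ℕ} (hlaw : LevelSepPP L m i.Ω ΛbP s)
    (hK₆ : 0 < K₆) {B₀ δ₀ a₀ : ℝ} (hB₀ : 0 < B₀)
    (h33U : ∀ (α₀ : ℝ) (U₀ : Site d → Fin d → 𝔸ˣ) (hU₀ : ∀ x κ, U₀ x κ ∈ unitaryUnits 𝔸), 0 < α₀ → M * α₀ ≤ a₀ →
      (bg (mem M i m)).Reg335 c35 α₀ (ιCfg M i m U₀ hU₀) →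
      B9.Ineq342_346_347 (GA (mem M i m)) B₀ δ₀ (ιCfg M i m U₀ hU₀)) :
    SockB9P3D4β (𝔸 := 𝔸) L (max 1 (2 * B₀ * max 1 (qQ d L Cτ (betaTau τ) s)))
      ((20 * d + 2) * max 1 (2 * B₀ * max 1 (qQ d L Cτ (betaTau τ) s)))
      (min (1 / 16) (min (c₆ / M) (min (a₀ / (K₆ * M)) (min (a₃ / (K₆ * M)) (1 / (2 * B₀ * (14 * ((d - 1 : ℕ) : ℝ)) * M + 1))))))
      i.η m i.Ω i.Λs ΛbP := by
  have hL1 : 1 ≤ L := le_trans (by norm_num) hL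
  have hq : 0 ≤ qQ d L Cτ (betaTau τ) s := by
    have hCτ0 : 0 ≤ Cτ := by
      have h := hCτ 1 1
      rw [star_one, one_mul, norm_one, mul_one, mul_one] at h
      exact le_trans (abs_nonneg _) h
    have hβ : 0 ≤ betaTau τ := by
      unfold betaTau
      split_ifs
      · exact Finset.sum_nonneg fun i _ => mul_nonneg (norm_nonneg _) (norm_nonneg _)
      · exact le_rfl
    have hα : 0 ≤ B9Eq316AveragingTransposeZd.alphaQ d L := (B9Eq316AveragingTransposeZd.alphaQ_pos d hL1).le
    have hθ : 0 ≤ B7Prop5GeneralLevels.thetaGen d L (B9Eq316AveragingTransposeZd.alphaQ d L) := by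
      unfold B7Prop5GeneralLevels.thetaGen; positivity
    unfold qQ; positivity
  exact sockB9P3D4γI_at (geo := geo) (bg := bg) (GA := GA) (L := L) (mem := mem) (ιCfg := ιCfg) (ιLoc := ιLoc) (ops := opsAllZd τ L ΛbP ops₀)
    hd2 hL1 hM1 i hMi hdict hP6
    (invAt_opsAllZd_of_posDef τ L ΛbP ops₀ M i m bg mem ιCfg hL c35 a₃ hΩ (hbox_of_levelSepPP L ΛbP i m hlaw) hpos)
    (curvAtInAk_opsAllZd τ L ΛbP ops₀ hL1 hM1 i m) (landauAt_opsAllZd τ L ΛbP ops₀ M i m bg mem ιCfg hτt hτs hτp c35 a₃ hΩ) ΛbP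
    (avgAtγ_opsAllZd τ L ΛbP ops₀ M i m hd2 hL hCτ hlaw) hsee hK₆ (by positivity) hq hB₀ h33U

end Binders

end Literature.MathematicalPhysics.QuantumFieldTheory.Balaban1983to89.B9SupplySockB9P3ZdAllLettersZd

end
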